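import Literature.MathematicalPhysics.QuantumLattice.HubbardWindowCertificateAffine
import Literature.MathematicalPhysics.QuantumLattice.HubbardModelThermodynamicLimitProofs
import HarnessLib

/-!
# The ground-state energy density of the half-filled Hubbard chain (thermodynamic limit)

Topic `MathematicalPhysics/QuantumLattice` (family `hubbard`). The tree proves that the energy per
site of the half-filled Hubbard ring `E_L(L)/L` (`energyPerSite (fermionTorusGraph 1 L) t U L`,
`hubbardChain L = fermionTorusGraph 1 L`) converges as `L → ∞` for every hopping `t` and every
`U ≥ 0` (`ThermodynamicLimit.tendsto_energyPerSite_ring`, Fekete's lemma on the ring cut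
`groundEnergyAt_ring_le_add`; Ruelle, *Statistical Mechanics* (1969), §2.2). This file NAMES the
limit,

* `hubbardChainEnergyDensity t U = lim_{L→∞} E_L(L)/L` (a `limUnder`, used only through its
  `Tendsto` theorems `tendsto_hubbardChainEnergyDensity`, `tendsto_hubbardChainEnergyDensity_even`),

and records the three ways it is USED by certified bounds (bundle `pub-mbboot`, certified SOS /
moment-relaxation lower bounds and exact-diagonalisation enclosures for Hubbard rings and chains):

* **the limit is an infimum** — for every finite ring `L ≥ 1`,
  `e ≤ E_L(L)/L + 8|t|/L` (`hubbardChainEnergyDensity_le`; subadditivity of `E_L(L) + 8|t|`), so a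
  certified UPPER bound on one finite half-filled ring is a certified upper bound on `e`
  (`hubbardChainEnergyDensity_le_of_le`);
* **eventual ring-wise lower bounds pass to the limit** — if `q ≤ E_L(L)/L` for all large EVEN `L`
  then `q ≤ e` (`hubbardChainEnergyDensity_ge_of_eventually_ge`; this is the shape of the bundle's
  ring-wise rows `sdp_lower_TL_*`), and the window-certificate form
  `hubbardChainEnergyDensity_ge_of_window_certificate`: ONE identity in the CAR algebra of a finite
  window `Λ' ⊂ ℤ` (the hypothesis `hcert` of
  `hubbardChain_groundEnergyAt_div_ge_of_window_certificate`, `HubbardWindowCertificateAffine.lean`)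
  gives `c − Σₖ ‖aₖ‖ ≤ hubbardChainEnergyDensity t U` — unconditionally, for every `t` and `U ≥ 0`;
* **identification with the Lieb–Wu energy** — under the tree's named fact `lieb_wu` (Lieb–Wu 1968,
  eq. (20); rigour status recorded at its docstring), `hubbardChainEnergyDensity 1 U = liebWuEnergy U`
  for `U > 0` (`hubbardChainEnergyDensity_eq_liebWuEnergy`), so that the conditional
  `liebWuEnergy_ge_of_window_certificate` and the unconditional statement here agree.

Everything is proved; the only definition is the name of the limit. No named facts.

## References

* D. Ruelle, *Statistical Mechanics: Rigorous Results* (Benjamin, 1969), §2.2 (thermodynamic limit by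
  subadditivity; the limit is the infimum of the finite-volume densities up to boundary terms).
* E. H. Lieb, F. Y. Wu, *Absence of Mott transition in an exact solution of the short-range one-band
  model in one dimension*, Phys. Rev. Lett. 20 (1968) 1445, eq. (20) (`e(U)` at half filling).
* X. Han, *Quantum many-body bootstrap*, arXiv:2006.06002 (2020), §2 (1D Hubbard bootstrap lower
  bounds in the thermodynamic limit, compared with Lieb–Wu).
-/

noncomputable section

open Filter Topology Matrix Finset
open scoped BigOperators

namespace Literature.MathematicalPhysics.QuantumLattice

namespace ThermodynamicLimit

/-! ### The limit and its defining `Tendsto` -/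

/-- **The ground-state energy density of the half-filled Hubbard chain**,
`e(t, U) = lim_{L→∞} E_L(L)/L` along the rings `ℤ/Lℤ` (`fermionTorusGraph 1 L`), where
`E_L(L) = groundEnergyAt (fermionTorusGraph 1 L) t U L` is the sector ground-state energy with `L`
electrons (all `S^z`). A `limUnder`; the limit exists for `U ≥ 0`
(`tendsto_hubbardChainEnergyDensity`). Ruelle (1969) §2.2; Lieb–Wu 1968 eq. (20) identify it with
the Bethe-ansatz value for `t = 1` (see `hubbardChainEnergyDensity_eq_liebWuEnergy`).
[cite: Ruelle1969, §2.2] -/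
def hubbardChainEnergyDensity (t U : ℝ) : ℝ :=
  limUnder atTop (fun L : ℕ => energyPerSite (fermionTorusGraph 1 L) t U L)

/-- The defining limit: `E_L(L)/L → e(t, U)` for `U ≥ 0`. [cite: Ruelle1969, §2.2] -/
theorem tendsto_hubbardChainEnergyDensity (t : ℝ) {U : ℝ} (hU : 0 ≤ U) :
    Tendsto (fun L : ℕ => energyPerSite (fermionTorusGraph 1 L) t U L) atTop
      (𝓝 (hubbardChainEnergyDensity t U)) :=
  tendsto_nhds_limUnder (tendsto_energyPerSite_ring t hU)

/-- The same limit along the even rings `L = 2n` (the setting of `lieb_wu` and of the bundle's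
ring-wise rows; `hubbardChain (2n) = fermionTorusGraph 1 (2n)`). [cite: Ruelle1969, §2.2] -/
theorem tendsto_hubbardChainEnergyDensity_even (t : ℝ) {U : ℝ} (hU : 0 ≤ U) :
    Tendsto (fun n : ℕ => energyPerSite (fermionTorusGraph 1 (2 * n)) t U (2 * n)) atTop
      (𝓝 (hubbardChainEnergyDensity t U)) := by
  have h2 : Tendsto (fun n : ℕ => 2 * n) atTop atTop :=
    tendsto_atTop_atTop.2 fun b => ⟨b, fun a ha => by omega⟩
  exact (tendsto_hubbardChainEnergyDensity t hU).comp h2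

/-- `energyPerSite` of the ring is `E_L(N)/L`. [folklore] -/
theorem energyPerSite_fermionTorusGraph_one (t U : ℝ) (L N : ℕ) :
    energyPerSite (fermionTorusGraph 1 L) t U N = groundEnergyAt (fermionTorusGraph 1 L) t U N / (L : ℝ) := by
  have hcard : Fintype.card (FermionTorus 1 L) = L := by simp [FermionTorus, Fintype.card_lex]
  rw [energyPerSite, hcard]

/-! ### The limit is an infimum: finite rings bound it from above -/

/-- **Subadditive upper bound at every finite size.** For `U ≥ 0` and every ring `L ≥ 1`:
`e(t, U) ≤ E_L(L)/L + 8|t|/L`. Proof: `u(L) = E_L(L) + 8|t|` is subadditive by the ring cut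
(`groundEnergyAt_ring_le_add`), hence `u(kL) ≤ k·u(L) + u(0)` and `E_{kL}(kL)/(kL) ≤ u(L)/L + u(0)/(kL)`;
let `k → ∞`. (Ruelle (1969) §2.2: the thermodynamic limit is the infimum of the finite-volume
densities corrected by the surface term.) [cite: Ruelle1969, §2.2] -/
theorem hubbardChainEnergyDensity_le (t : ℝ) {U : ℝ} (hU : 0 ≤ U) {L : ℕ} (hL : 1 ≤ L) :
    hubbardChainEnergyDensity t U ≤
      groundEnergyAt (fermionTorusGraph 1 L) t U L / (L : ℝ) + 8 * |t| / L := by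
  set u : ℕ → ℝ := fun L => groundEnergyAt (fermionTorusGraph 1 L) t U L + 8 * |t| with hu
  have hsub : Subadditive u := by
    intro m n
    have h := groundEnergyAt_ring_le_add m n t U (N₁ := m) (N₂ := n) (by omega) (by omega)
    simp only [hu]
    linarith
  -- along the subsequence `k L`, `k = j + 1`
  have hseq : Tendsto (fun j : ℕ => (j + 1) * L) atTop atTop :=
    tendsto_atTop_mono (fun j => (Nat.le_succ j).trans (Nat.le_mul_of_pos_right _ hL)) tendsto_id
  have hlim := (tendsto_hubbardChainEnergyDensity t hU).comp hseq
  -- the comparison sequence `u(L)/L + u(0)/(kL)` tends to `u(L)/L`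
  have hLpos : (0 : ℝ) < L := by exact_mod_cast hL
  have hcomp : Tendsto (fun j : ℕ => u L / L + u 0 / (((j + 1) * L : ℕ) : ℝ)) atTop
      (𝓝 (u L / L + 0)) := by
    refine tendsto_const_nhds.add ?_
    have h1 : Tendsto (fun j : ℕ => (((j + 1) * L : ℕ) : ℝ)) atTop atTop := by
      exact tendsto_natCast_atTop_atTop.comp hseq
    exact tendsto_const_nhds.div_atTop h1
  rw [add_zero] at hcomp
  have hle : ∀ j : ℕ, energyPerSite (fermionTorusGraph 1 ((j + 1) * L)) t U ((j + 1) * L) ≤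
      u L / L + u 0 / (((j + 1) * L : ℕ) : ℝ) := by
    intro j
    rw [energyPerSite_fermionTorusGraph_one]
    have hk := hsub.apply_mul_add_le (j + 1) L 0
    rw [add_zero] at hk
    have hkL : (0 : ℝ) < (((j + 1) * L : ℕ) : ℝ) := by positivity
    rw [div_le_iff₀ hkL]
    have hE : groundEnergyAt (fermionTorusGraph 1 ((j + 1) * L)) t U ((j + 1) * L) =
        u ((j + 1) * L) - 8 * |t| := by simp [hu]
    rw [hE]
    have ht : 0 ≤ 8 * |t| := by positivity
    have hexp : (u L / L + u 0 / (((j + 1) * L : ℕ) : ℝ)) * (((j + 1) * L : ℕ) : ℝ) =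
        ((j + 1 : ℕ) : ℝ) * u L + u 0 := by
      field_simp
      push_cast
      ring
    rw [hexp]
    linarith
  have := le_of_tendsto_of_tendsto' hlim hcomp hle
  simpa [hu, add_div] using this

/-- **A certified upper bound on one half-filled ring bounds the thermodynamic limit**:
`E_L(L) ≤ B` (`L ≥ 1`, `U ≥ 0`) gives `e(t, U) ≤ B/L + 8|t|/L`. This is the shape of the bundle's
exact-diagonalisation / exact-Rayleigh-quotient enclosures of Hubbard rings turned into a
thermodynamic-limit statement. [cite: Ruelle1969, §2.2] -/
theorem hubbardChainEnergyDensity_le_of_le (t : ℝ) {U : ℝ} (hU : 0 ≤ U) {L : ℕ} (hL : 1 ≤ L) {B : ℝ}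
    (h : groundEnergyAt (fermionTorusGraph 1 L) t U L ≤ B) :
    hubbardChainEnergyDensity t U ≤ B / (L : ℝ) + 8 * |t| / L := by
  have hLpos : (0 : ℝ) < L := by exact_mod_cast hL
  exact (hubbardChainEnergyDensity_le t hU hL).trans (by gcongr)

/-! ### Eventual ring-wise lower bounds pass to the limit -/

/-- **Ring-wise lower bounds on the even rings give a lower bound on the limit**: if
`q ≤ E_L(L)/L` for all sufficiently large even `L`, then `q ≤ e(t, U)` (`U ≥ 0`). This is the
logical form of the bundle's rows `∀ L, L₀ ≤ L → Even L → q ≤ groundEnergyAt (fermionTorusGraph 1 L) t U L / L`.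
[cite: Ruelle1969, §2.2] -/
theorem hubbardChainEnergyDensity_ge_of_eventually_ge (t : ℝ) {U : ℝ} (hU : 0 ≤ U) {q : ℝ}
    (h : ∀ᶠ L : ℕ in atTop, Even L → q ≤ groundEnergyAt (fermionTorusGraph 1 L) t U L / (L : ℝ)) :
    q ≤ hubbardChainEnergyDensity t U := by
  refine ge_of_tendsto (tendsto_hubbardChainEnergyDensity_even t hU) ?_
  obtain ⟨L₀, hL₀⟩ := eventually_atTop.1 h
  filter_upwards [eventually_ge_atTop L₀] with n hn
  rw [energyPerSite_fermionTorusGraph_one]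
  exact hL₀ (2 * n) (by omega) ⟨n, by ring⟩

/-- The same with an explicit threshold `L₀` (the literal shape of the bundle's ring-wise rows).
[cite: Ruelle1969, §2.2] -/
theorem hubbardChainEnergyDensity_ge_of_forall_ge (t : ℝ) {U : ℝ} (hU : 0 ≤ U) {q : ℝ} (L₀ : ℕ)
    (h : ∀ L : ℕ, L₀ ≤ L → Even L → q ≤ groundEnergyAt (fermionTorusGraph 1 L) t U L / (L : ℝ)) :
    q ≤ hubbardChainEnergyDensity t U :=
  hubbardChainEnergyDensity_ge_of_eventually_ge t hU (eventually_atTop.2 ⟨L₀, h⟩)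

/-! ### Identification with the Lieb–Wu energy (conditional on `lieb_wu`) -/

/-- **Under `lieb_wu`, the limit is the Lieb–Wu energy**: for `t = 1` and `U > 0`,
`hubbardChainEnergyDensity 1 U = liebWuEnergy U = −4 ∫₀^∞ J₀(ω)J₁(ω)/(ω(1 + e^{ωU/2})) dω`
(uniqueness of the limit along the even rings; part (i) of the tree's named fact `lieb_wu`, whose
rigour status is recorded at its docstring). [cite: LiebWuPRL1968, eq. (20)] -/
theorem hubbardChainEnergyDensity_eq_liebWuEnergy (hlw : lieb_wu) {U : ℝ} (hU : 0 < U) :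
    hubbardChainEnergyDensity 1 U = Literature.Analysis.FunctionSpaces.liebWuEnergy U :=
  tendsto_nhds_unique (tendsto_hubbardChainEnergyDensity_even 1 hU.le) (hlw U hU).1

/-! ### Window certificates bound the limit -/

section Window

open HubbardWave0 Literature.Probability.LatticeModels
open Literature.MathematicalPhysics.QuantumManyBody.StateRelaxation
open scoped ComplexOrder

/-- **Window certificate at half filling ⇒ lower bound on the thermodynamic-limit energy density of
the Hubbard chain** — unconditional, every hopping `t` and every `U ≥ 0`. The data and the identity
`hcert` are exactly those of `hubbardChain_groundEnergyAt_div_ge_of_window_certificate`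
(`HubbardWindowCertificateAffine.lean`: objective `Γ(incl) E_Φ`, density constraints `n_{0σ} − ½·1`,
Gram term, equations of motion, affine symmetry differences `x ↦ εx + v`, charged ladder words, real
multiples of `Vᴴ − V`, residual ladder words), which gives `c − Σₖ ‖aₖ‖ ≤ E_L(L)/L` on every even ring
`L ≥ 3` on which `x ↦ x mod L` is injective on `thicken Λ' 1` — hence on all large even rings
(`exists_forall_le_injOn_proj`) — and `hubbardChainEnergyDensity_ge_of_eventually_ge` passes to the
limit: `c − Σₖ ‖aₖ‖ ≤ hubbardChainEnergyDensity t U`. For `t = 1` and under `lieb_wu` this is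
`liebWuEnergy_ge_of_window_certificate`. Han 2020 §2 (1D bootstrap lower bounds in the
thermodynamic limit). [cite: Han2020Bootstrap, §2] [cite: Ruelle1969, §2.2] -/
theorem hubbardChainEnergyDensity_ge_of_window_certificate (t : ℝ) {U : ℝ} (hU : 0 ≤ U)
    {Λ Λ' : Finset (Site 1)} (hΛ : Λ ⊆ Λ')
    (hclosed : ∀ x ∈ Λ, ∀ i : Fin 1, x + unitVec i ∈ Λ' ∧ x - unitVec i ∈ Λ')
    (h0 : thicken ({0} : Finset (Site 1)) 1 ⊆ Λ') (hz : (0 : Site 1) ∈ Λ')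
    (μ : Fin 2 → ℝ)
    {m : Type*} [Fintype m] [DecidableEq m] {Λm : Matrix m m ℂ} (hΛm : Λm.PosSemidef)
    (O : m → FermionOp Λ')
    {κ : Type*} (s : Finset κ) (B : κ → FermionOp Λ)
    {ι : Type*} (tt : Finset ι) (ε : ι → ℤˣ) (v : ι → Site 1)
    (hsh : ∀ l, affShiftSet (ε l) (v l) Λ ⊆ Λ')
    (Y : ι → FermionOp Λ)
    {γ : Type*} (u : Finset γ) (b : γ → ℂ) (cw : γ → List (Orb (PolySite Λ') × Bool))
    (hcw : ∀ j ∈ u, ladderCharge (cw j) ≠ 0 ∨ ladderSpinCharge (cw j) ≠ 0)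
    {δ : Type*} (ah : Finset δ) (dc : δ → ℝ) (V : δ → FermionOp Λ')
    {κ'' : Type*} (w : Finset κ'') (a : κ'' → ℂ) (word : κ'' → List (Orb (PolySite Λ') × Bool))
    {c : ℝ}
    (hcert : fermionEmbed (PolySite.incl h0) ((hubbardFermionInteraction 1 t U).meanEnergyObs 1) -
        (c : ℂ) • (1 : FermionOp Λ') -
        ∑ σ : Fin 2, ((μ σ : ℝ) : ℂ) • (nAt 0 hz σ - ((1 / 2 : ℝ) : ℂ) • (1 : FermionOp Λ')) =
      gramForm Λm O +
        (∑ k ∈ s, ((hubbardFermionInteraction 1 t U).localHamiltonian Λ' *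
              fermionEmbed (PolySite.incl hΛ) (B k) -
            fermionEmbed (PolySite.incl hΛ) (B k) * (hubbardFermionInteraction 1 t U).localHamiltonian Λ') +
          ∑ l ∈ tt, (fermionEmbed (PolySite.incl (hsh l))
              (fermionEmbed (PolySite.affEmb (ε l) (v l) Λ) (Y l)) -
            fermionEmbed (PolySite.incl hΛ) (Y l)) +
          ∑ j ∈ u, b j • ladderWord (cw j)) +
        (∑ m' ∈ ah, ((dc m' : ℝ) : ℂ) • ((V m')ᴴ - V m') + ∑ k ∈ w, a k • ladderWord (word k))) :
    c - ∑ k ∈ w, ‖a k‖ ≤ hubbardChainEnergyDensity t U := by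
  obtain ⟨L₀, hL₀⟩ := exists_forall_le_injOn_proj (thicken Λ' 1)
  refine hubbardChainEnergyDensity_ge_of_forall_ge t hU (max L₀ 3) fun L hL hLe => ?_
  have hL3 : 3 ≤ L := le_trans (le_max_right _ _) hL
  have hLL : L₀ ≤ L := le_trans (le_max_left _ _) hL
  haveI : NeZero L := ⟨by omega⟩
  exact hubbardChain_groundEnergyAt_div_ge_of_window_certificate (L := L) t U hL3 hLe hΛ hclosed h0 hz
    (hL₀ L hLL) μ hΛm O s B tt ε v hsh Y u b cw hcw ah dc V w a word hcert

end Window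

end ThermodynamicLimit

end Literature.MathematicalPhysics.QuantumLattice
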